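import Mathlib
import Summits.NavierStokesRegularity.NavierStokesRegularity.Theorems.SlicedKelvinPlanarFluxAPrioriEpsilonLimit
import Summits.NavierStokesRegularity.NavierStokesRegularity.Theorems.SlicedKelvinPlanarFluxAPrioriFoliation
import Summits.NavierStokesRegularity.NavierStokesRegularity.Theorems.SlicedKelvinPlanarFluxAPrioriPlaneCalculus
import Summits.NavierStokesRegularity.NavierStokesRegularity.Theorems.SlicedKelvinPlanarFluxAPrioriFoldDecay

/-!
# Crux `SlicedKelvin.PlanarFluxAPriori` (stmt-NavierStokesRegularity-15600), line `Sketch`: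
  STUB `stub_slabSplit`

Lands `--supports stmt-NavierStokesRegularity-15600` the registered stub `stub_slabSplit` of the lead's
skeleton `Cruxes/PlanarFluxAPriori/Lines/Sketch.lean`: the kinematic bookkeeping that turns the apex
Lipschitz law (the statement of the neighbouring stub `stub_apexLipschitz`, taken here as a HYPOTHESIS)
into the slab split of the planar vorticity flux.

Notation: `n = R e₂`, `f = ⟪curl v, n⟫`, `F_ε = √(f² + ε²)`, apex density
`a_ε = (ε²/F_ε³)|Df[curl v]| ≥ 0`, planar flux `Φ(c) = ∫⁻_{ℝ²} ‖f(R(y,c))‖ₑ dy`, regularised flux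
`g_ε(c) = ∫_{ℝ²} f²/F_ε (R(y,c)) dy`. The hypothesis says `g_ε(c) ≤ g_ε(c') + ∫_{slab(c,c')} a_ε`.

Proof.
1. Pointwise `√(s²+ε²) − ε ≤ s²/√(s²+ε²) ≤ |s|` (`slabSplit_sqrt_sub_le_sq_div`, `slabSplit_sq_div_le_abs`).
2. For `|c' − c| < h`: `slab(c,c') ⊆ S_h(c) = {x | |⟪x,n⟫ − c| < h}` (`slabSplit_slab_subset`), so
   `ofReal (g_ε c) ≤ Φ(c') + A_ε`, `A_ε = ∫⁻_{S_h(c)} ofReal a_ε` (`ofReal ∫ ≤ ∫⁻ ofReal`, monotonicity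
   of `lintegral` in the set).
3. Average over `c' ∈ (c − h, c + h)` and use Fubini over the foliation
   (`setLIntegral_lintegral_foliation_le`): `ofReal (2h) · ofReal (g_ε c) ≤ ‖f‖_{L¹} + ofReal (2h) · A_ε`,
   then divide (`slabSplit_average`, `slabSplit_div`).
4. `ε → 0⁺`: `∫⁻ ofReal (F_ε − ε) ≤ ofReal (g_ε c)` by step 1 (the plane integrand is integrable by cubic
   decay, `decay_inner_curl` + `integrable_plane_of_norm_le`), and `lintegral_enorm_le_add_mul_liminf`
   (EpsilonLimit) passes to `Φ(c) ≤ ‖f‖_{L¹}/(2h) + liminf_{ε→0⁺} A_ε`.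
-/

noncomputable section

namespace Summit.NavierStokesRegularity.NavierStokesRegularity.Theorems.SlicedKelvinPlanarFluxAPriori

set_option linter.dupNamespace false
-- the summit and its single sub-problem share the name (CONVENTIONS §1)

open MeasureTheory Set Filter
open scoped ENNReal NNReal Topology
open Literature.Analysis.FluidPDE


/-! ### Step 1: pointwise inequalities for the regularisation -/

/-- `s²/√(s²+ε²) ≤ |s|`: the regularised flux density is dominated by the modulus. -/
theorem slabSplit_sq_div_le_abs (s ε : ℝ) : s ^ 2 / Real.sqrt (s ^ 2 + ε ^ 2) ≤ |s| := by
  rcases eq_or_lt_of_le (Real.sqrt_nonneg (s ^ 2 + ε ^ 2)) with h | h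
  · rw [← h, div_zero]
    exact abs_nonneg s
  · rw [div_le_iff₀ h]
    have h1 := abs_le_sqrt_sq_add_sq s ε
    nlinarith [abs_nonneg s, sq_abs s]

/-- `√(s²+ε²) − ε ≤ s²/√(s²+ε²)` for `ε > 0`: the regularised modulus is dominated by the regularised
flux density (`(F − ε)F = s² + ε² − εF ≤ s²` since `ε ≤ F`). -/
theorem slabSplit_sqrt_sub_le_sq_div (s : ℝ) {ε : ℝ} (hε : 0 < ε) :
    Real.sqrt (s ^ 2 + ε ^ 2) - ε ≤ s ^ 2 / Real.sqrt (s ^ 2 + ε ^ 2) := by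
  have hF := sqrt_sq_add_sq_pos hε s
  rw [le_div_iff₀ hF]
  have h1 := le_sqrt_sq_add_sq hε.le s
  have h2 := Real.sq_sqrt (show (0 : ℝ) ≤ s ^ 2 + ε ^ 2 by positivity)
  nlinarith

/-! ### Step 2: `ofReal ∫ ≤ ∫⁻ ofReal` and the slab geometry -/

section Generic

variable {β : Type*} [MeasurableSpace β] {μ : Measure β}

/-- `ofReal (∫ g) ≤ ∫⁻ ofReal (g ·)` for every real `g` (both sides discard the negative part; the left
side vanishes for a non-integrable `g`). -/
theorem slabSplit_ofReal_integral_le (g : β → ℝ) :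
    ENNReal.ofReal (∫ b, g b ∂μ) ≤ ∫⁻ b, ENNReal.ofReal (g b) ∂μ := by
  by_cases hg : Integrable g μ
  · calc ENNReal.ofReal (∫ b, g b ∂μ) ≤ ENNReal.ofReal (∫ b, max (g b) 0 ∂μ) :=
          ENNReal.ofReal_le_ofReal (integral_mono hg hg.pos_part fun b => le_max_left _ _)
      _ = ∫⁻ b, ENNReal.ofReal (max (g b) 0) ∂μ :=
          ofReal_integral_eq_lintegral_ofReal hg.pos_part
            (Eventually.of_forall fun b => le_max_right _ _)
      _ = ∫⁻ b, ENNReal.ofReal (g b) ∂μ := lintegral_congr fun b => by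
          rcases le_total (g b) 0 with h | h
          · rw [max_eq_right h, ENNReal.ofReal_zero, ENNReal.ofReal_of_nonpos h]
          · rw [max_eq_left h]
  · rw [integral_undef hg, ENNReal.ofReal_zero]
    exact bot_le

/-- `ofReal (∫ u²/√(u²+ε²)) ≤ ∫⁻ ‖u‖ₑ`: the regularised flux is at most the unsigned flux. -/
theorem slabSplit_ofReal_integral_sq_div_le (u : β → ℝ) (ε : ℝ) :
    ENNReal.ofReal (∫ b, u b ^ 2 / Real.sqrt (u b ^ 2 + ε ^ 2) ∂μ) ≤ ∫⁻ b, ‖u b‖ₑ ∂μ :=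
  (slabSplit_ofReal_integral_le _).trans (lintegral_mono fun b => by
    rw [Real.enorm_eq_ofReal_abs]
    exact ENNReal.ofReal_le_ofReal (slabSplit_sq_div_le_abs _ _))

/-- `∫⁻ ofReal (√(u²+ε²) − ε) ≤ ofReal (∫ u²/√(u²+ε²))` for an integrable regularised flux density
and `ε > 0`. -/
theorem slabSplit_lintegral_sub_le_ofReal_integral (u : β → ℝ) {ε : ℝ} (hε : 0 < ε)
    (hint : Integrable (fun b => u b ^ 2 / Real.sqrt (u b ^ 2 + ε ^ 2)) μ) :
    ∫⁻ b, ENNReal.ofReal (Real.sqrt (u b ^ 2 + ε ^ 2) - ε) ∂μ ≤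
      ENNReal.ofReal (∫ b, u b ^ 2 / Real.sqrt (u b ^ 2 + ε ^ 2) ∂μ) := by
  rw [ofReal_integral_eq_lintegral_ofReal hint
    (ae_of_all _ fun b => div_nonneg (sq_nonneg _) (Real.sqrt_nonneg _))]
  exact lintegral_mono fun b => ENNReal.ofReal_le_ofReal (slabSplit_sqrt_sub_le_sq_div _ hε)

/-- `ofReal (∫_{s} a) ≤ ∫⁻_{t} ofReal a` for `s ⊆ t`. -/
theorem slabSplit_ofReal_setIntegral_le {s t : Set β} (hst : s ⊆ t) (a : β → ℝ) :
    ENNReal.ofReal (∫ b in s, a b ∂μ) ≤ ∫⁻ b in t, ENNReal.ofReal (a b) ∂μ :=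
  (slabSplit_ofReal_integral_le (μ := μ.restrict s) a).trans (lintegral_mono_set hst)

end Generic

/-- For `c' ∈ (c − h, c + h)` the slab between the planes `⟪x,n⟫ = c` and `⟪x,n⟫ = c'` lies in the slab
of half-width `h` about the plane `⟪x,n⟫ = c`. -/
theorem slabSplit_slab_subset (n : EuclideanSpace ℝ (Fin 3)) {c c' h : ℝ}
    (hc' : c' ∈ Ioo (c - h) (c + h)) :
    {x : EuclideanSpace ℝ (Fin 3) | inner ℝ x n ∈ Set.uIcc c c'} ⊆
      {x : EuclideanSpace ℝ (Fin 3) | |inner ℝ x n - c| < h} := by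
  intro x hx
  simp only [Set.mem_setOf_eq] at hx ⊢
  have h1 : |c' - c| < h := abs_lt.2 ⟨by linarith [hc'.1], by linarith [hc'.2]⟩
  exact (Set.abs_sub_left_of_mem_uIcc hx).trans_lt h1

/-! ### Step 3: averaging over the heights `c' ∈ (c − h, c + h)` -/

/-- Averaging over heights: if `X ≤ Φ c' + A` for all `c' ∈ (c − h, c + h)` and
`∫⁻_{(c−h,c+h)} Φ ≤ L`, then `X · ofReal (2h) ≤ L + A · ofReal (2h)`. -/
theorem slabSplit_average {X A L : ℝ≥0∞} {Φ : ℝ → ℝ≥0∞} {c h : ℝ}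
    (h2 : ∀ c' ∈ Ioo (c - h) (c + h), X ≤ Φ c' + A)
    (hL : ∫⁻ c' in Ioo (c - h) (c + h), Φ c' ≤ L) :
    X * ENNReal.ofReal (2 * h) ≤ L + A * ENNReal.ofReal (2 * h) := by
  have hvol : volume (Ioo (c - h) (c + h)) = ENNReal.ofReal (2 * h) := by
    rw [Real.volume_Ioo]
    congr 1
    ring
  calc X * ENNReal.ofReal (2 * h) = ∫⁻ _ in Ioo (c - h) (c + h), X := by
        rw [setLIntegral_const, hvol]
    _ ≤ ∫⁻ c' in Ioo (c - h) (c + h), (Φ c' + A) := setLIntegral_mono' measurableSet_Ioo h2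
    _ = (∫⁻ c' in Ioo (c - h) (c + h), Φ c') + ∫⁻ _ in Ioo (c - h) (c + h), A :=
        lintegral_add_right _ measurable_const
    _ ≤ L + A * ENNReal.ofReal (2 * h) := by
        rw [setLIntegral_const, hvol]
        exact add_le_add hL le_rfl

/-- Averaging arithmetic in `ℝ≥0∞`: `X · d ≤ L + A · d` with `d = ofReal (2h)`, `h > 0`, gives
`X ≤ ofReal (1/(2h)) · L + A`. -/
theorem slabSplit_div {X L A : ℝ≥0∞} {h : ℝ} (hh : 0 < h)
    (hX : X * ENNReal.ofReal (2 * h) ≤ L + A * ENNReal.ofReal (2 * h)) :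
    X ≤ ENNReal.ofReal (1 / (2 * h)) * L + A := by
  have hd0 : ENNReal.ofReal (2 * h) ≠ 0 := (ENNReal.ofReal_pos.2 (by positivity)).ne'
  have hdt : ENNReal.ofReal (2 * h) ≠ ∞ := ENNReal.ofReal_ne_top
  have hinv : ENNReal.ofReal (1 / (2 * h)) = (ENNReal.ofReal (2 * h))⁻¹ := by
    rw [one_div, ENNReal.ofReal_inv_of_pos (by positivity)]
  calc X = X * ENNReal.ofReal (2 * h) * (ENNReal.ofReal (2 * h))⁻¹ := by
        rw [mul_assoc, ENNReal.mul_inv_cancel hd0 hdt, mul_one]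
    _ ≤ (L + A * ENNReal.ofReal (2 * h)) * (ENNReal.ofReal (2 * h))⁻¹ := by gcongr
    _ = (ENNReal.ofReal (2 * h))⁻¹ * L + A := by
        rw [add_mul, mul_assoc, ENNReal.mul_inv_cancel hd0 hdt, mul_one, mul_comm]
    _ = ENNReal.ofReal (1 / (2 * h)) * L + A := by rw [hinv]

/-! ### The `ε`-level slab split and the passage `ε → 0⁺` -/

/-- **The `ε`-level slab split.** For a measurable `f : ℝ³ → ℝ`, a frame `R` (`n = R e₂`), a height
`c`, `h > 0`, `ε > 0` and any density `a`: if the regularised flux `g_ε(c) = ∫_{Π_c} f²/√(f²+ε²)` (with an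
integrable integrand on `Π_c`) obeys `g_ε(c) ≤ g_ε(c') + ∫_{slab(c,c')} a` for every `c'`, then
`∫⁻_{Π_c} ofReal (√(f²+ε²) − ε) ≤ ofReal (1/(2h)) · ∫⁻ ‖f‖ₑ + ∫⁻_{|⟪x,n⟫−c|<h} ofReal a`. -/
theorem slabSplit_eps (R : EuclideanSpace ℝ (Fin 3) ≃ₗᵢ[ℝ] EuclideanSpace ℝ (Fin 3)) (c : ℝ) {h : ℝ}
    (hh : 0 < h) {f : EuclideanSpace ℝ (Fin 3) → ℝ} (hfm : Measurable f)
    (a : EuclideanSpace ℝ (Fin 3) → ℝ) {ε : ℝ} (hε : 0 < ε)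
    (hint : Integrable (fun y : EuclideanSpace ℝ (Fin 2) => f (R (WithLp.toLp 2 ![y 0, y 1, c])) ^ 2 /
      Real.sqrt (f (R (WithLp.toLp 2 ![y 0, y 1, c])) ^ 2 + ε ^ 2)))
    (hLip : ∀ c' : ℝ, ∫ y : EuclideanSpace ℝ (Fin 2), f (R (WithLp.toLp 2 ![y 0, y 1, c])) ^ 2 /
        Real.sqrt (f (R (WithLp.toLp 2 ![y 0, y 1, c])) ^ 2 + ε ^ 2) ≤
      (∫ y : EuclideanSpace ℝ (Fin 2), f (R (WithLp.toLp 2 ![y 0, y 1, c'])) ^ 2 /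
        Real.sqrt (f (R (WithLp.toLp 2 ![y 0, y 1, c'])) ^ 2 + ε ^ 2)) +
      ∫ x in {x : EuclideanSpace ℝ (Fin 3) | inner ℝ x (R (EuclideanSpace.single 2 1)) ∈ Set.uIcc c c'},
        a x) :
    ∫⁻ y : EuclideanSpace ℝ (Fin 2), ENNReal.ofReal
        (Real.sqrt (f (R (WithLp.toLp 2 ![y 0, y 1, c])) ^ 2 + ε ^ 2) - ε) ≤
      ENNReal.ofReal (1 / (2 * h)) * (∫⁻ x, ‖f x‖ₑ) +
        ∫⁻ x in {x : EuclideanSpace ℝ (Fin 3) | |inner ℝ x (R (EuclideanSpace.single 2 1)) - c| < h},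
          ENNReal.ofReal (a x) := by
  have h2 : ∀ c' ∈ Ioo (c - h) (c + h),
      ENNReal.ofReal (∫ y : EuclideanSpace ℝ (Fin 2), f (R (WithLp.toLp 2 ![y 0, y 1, c])) ^ 2 /
        Real.sqrt (f (R (WithLp.toLp 2 ![y 0, y 1, c])) ^ 2 + ε ^ 2)) ≤
      (∫⁻ y : EuclideanSpace ℝ (Fin 2), ‖f (R (WithLp.toLp 2 ![y 0, y 1, c']))‖ₑ) +
        ∫⁻ x in {x : EuclideanSpace ℝ (Fin 3) | |inner ℝ x (R (EuclideanSpace.single 2 1)) - c| < h},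
          ENNReal.ofReal (a x) := by
    intro c' hc'
    refine (ENNReal.ofReal_le_ofReal (hLip c')).trans (ENNReal.ofReal_add_le.trans ?_)
    exact add_le_add (slabSplit_ofReal_integral_sq_div_le _ _)
      (slabSplit_ofReal_setIntegral_le (slabSplit_slab_subset _ hc') a)
  have h3 := slabSplit_average
    (Φ := fun c' => ∫⁻ y : EuclideanSpace ℝ (Fin 2), ‖f (R (WithLp.toLp 2 ![y 0, y 1, c']))‖ₑ)
    h2 (setLIntegral_lintegral_foliation_le R hfm.enorm (Ioo (c - h) (c + h)))
  exact (slabSplit_lintegral_sub_le_ofReal_integral _ hε hint).trans (slabSplit_div hh h3)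

/-- **The slab split for an abstract normal vorticity.** For a measurable `f : ℝ³ → ℝ`, a frame `R`,
a height `c`, `h > 0` and densities `a_ε`: if for every `ε > 0` the regularised flux has an integrable
integrand on `Π_c` and obeys the Lipschitz law `g_ε(c) ≤ g_ε(c') + ∫_{slab(c,c')} a_ε` for every `c'`,
then `Φ(c) ≤ ofReal (1/(2h)) · ∫⁻ ‖f‖ₑ + liminf_{ε→0⁺} ∫⁻_{|⟪x,n⟫−c|<h} ofReal a_ε`
(`slabSplit_eps` fed into `lintegral_enorm_le_add_mul_liminf` with `C = 1`, `ε₀ = 1`). -/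
theorem slabSplit_core (R : EuclideanSpace ℝ (Fin 3) ≃ₗᵢ[ℝ] EuclideanSpace ℝ (Fin 3)) (c : ℝ) {h : ℝ}
    (hh : 0 < h) {f : EuclideanSpace ℝ (Fin 3) → ℝ} (hfm : Measurable f)
    (a : ℝ → EuclideanSpace ℝ (Fin 3) → ℝ)
    (hint : ∀ ε : ℝ, 0 < ε → Integrable (fun y : EuclideanSpace ℝ (Fin 2) =>
      f (R (WithLp.toLp 2 ![y 0, y 1, c])) ^ 2 /
        Real.sqrt (f (R (WithLp.toLp 2 ![y 0, y 1, c])) ^ 2 + ε ^ 2)))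
    (hLip : ∀ ε : ℝ, 0 < ε → ∀ c' : ℝ,
      ∫ y : EuclideanSpace ℝ (Fin 2), f (R (WithLp.toLp 2 ![y 0, y 1, c])) ^ 2 /
        Real.sqrt (f (R (WithLp.toLp 2 ![y 0, y 1, c])) ^ 2 + ε ^ 2) ≤
      (∫ y : EuclideanSpace ℝ (Fin 2), f (R (WithLp.toLp 2 ![y 0, y 1, c'])) ^ 2 /
        Real.sqrt (f (R (WithLp.toLp 2 ![y 0, y 1, c'])) ^ 2 + ε ^ 2)) +
      ∫ x in {x : EuclideanSpace ℝ (Fin 3) | inner ℝ x (R (EuclideanSpace.single 2 1)) ∈ Set.uIcc c c'},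
        a ε x) :
    ∫⁻ y : EuclideanSpace ℝ (Fin 2), ‖f (R (WithLp.toLp 2 ![y 0, y 1, c]))‖ₑ ≤
      ENNReal.ofReal (1 / (2 * h)) * (∫⁻ x, ‖f x‖ₑ) +
        Filter.liminf (fun ε : ℝ =>
          ∫⁻ x in {x : EuclideanSpace ℝ (Fin 3) | |inner ℝ x (R (EuclideanSpace.single 2 1)) - c| < h},
            ENNReal.ofReal (a ε x)) (𝓝[>] (0 : ℝ)) := by
  have key := lintegral_enorm_le_add_mul_liminf (μ := volume)
    (f := fun y : EuclideanSpace ℝ (Fin 2) => f (R (WithLp.toLp 2 ![y 0, y 1, c])))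
    (M := ENNReal.ofReal (1 / (2 * h)) * (∫⁻ x, ‖f x‖ₑ)) (C := 1)
    (G := fun ε : ℝ =>
      ∫⁻ x in {x : EuclideanSpace ℝ (Fin 3) | |inner ℝ x (R (EuclideanSpace.single 2 1)) - c| < h},
        ENNReal.ofReal (a ε x))
    (hfm.comp (continuous_plane R c).measurable).aemeasurable one_pos (fun ε hε => by
      have hε' := slabSplit_eps R c hh hfm (a ε) hε.1 (hint ε hε.1) (hLip ε hε.1)
      simpa only [ENNReal.coe_one, one_mul] using hε')
  simpa only [ENNReal.coe_one, one_mul] using key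

/-- Cubic decay of `Dv, D²v, D³v` makes the regularised flux density `f²/√(f²+ε²)`, `f = ⟪curl v, n⟫`,
integrable on every plane `R{x₂ = c}` (it is continuous and `≤ |f| ≤ K (1 + ‖x‖)⁻³`). -/
theorem slabSplit_integrable (R : EuclideanSpace ℝ (Fin 3) ≃ₗᵢ[ℝ] EuclideanSpace ℝ (Fin 3)) (c : ℝ)
    {v : EuclideanSpace ℝ (Fin 3) → EuclideanSpace ℝ (Fin 3)} (hv : ContDiff ℝ (⊤ : ℕ∞) v) {C : ℝ}
    (hC : ∀ (x : EuclideanSpace ℝ (Fin 3)) (k : ℕ), k ≤ 3 →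
      (1 + ‖x‖) ^ 3 * ‖iteratedFDeriv ℝ k v x‖ ≤ C)
    {ε : ℝ} (hε : 0 < ε) (n : EuclideanSpace ℝ (Fin 3)) :
    Integrable (fun y : EuclideanSpace ℝ (Fin 2) =>
      inner ℝ (curl v (R (WithLp.toLp 2 ![y 0, y 1, c]))) n ^ 2 /
        Real.sqrt (inner ℝ (curl v (R (WithLp.toLp 2 ![y 0, y 1, c]))) n ^ 2 + ε ^ 2)) := by
  obtain ⟨K, hK⟩ := decay_inner_curl v C n hv hC
  have hfc : Continuous fun x : EuclideanSpace ℝ (Fin 3) => inner ℝ (curl v x) n :=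
    (contDiff_inner_curl hv n).continuous
  have hH : Continuous fun s : ℝ => s ^ 2 / Real.sqrt (s ^ 2 + ε ^ 2) :=
    (continuous_pow 2).div ((continuous_pow 2).add continuous_const).sqrt
      fun s => (sqrt_sq_add_sq_pos hε s).ne'
  refine integrable_plane_of_norm_le R
    (G := fun x => inner ℝ (curl v x) n ^ 2 / Real.sqrt (inner ℝ (curl v x) n ^ 2 + ε ^ 2))
    (hH.comp hfc) (K := K) (fun x => ?_) c
  have h0 := hK x 0 (Nat.zero_le 2)
  rw [norm_iteratedFDeriv_zero] at h0
  calc ‖inner ℝ (curl v x) n ^ 2 / Real.sqrt (inner ℝ (curl v x) n ^ 2 + ε ^ 2)‖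
      = inner ℝ (curl v x) n ^ 2 / Real.sqrt (inner ℝ (curl v x) n ^ 2 + ε ^ 2) :=
        Real.norm_of_nonneg (div_nonneg (sq_nonneg _) (Real.sqrt_nonneg _))
    _ ≤ |inner ℝ (curl v x) n| := slabSplit_sq_div_le_abs _ _
    _ = ‖inner ℝ (curl v x) n‖ := (Real.norm_eq_abs _).symm
    _ ≤ K * (1 + ‖x‖) ^ (-(3 : ℝ)) := le_mul_rpow_neg_three h0

/-- **STUB `stub_slabSplit`** (kinematic bookkeeping of the `Sketch` line of
`SlicedKelvin.PlanarFluxAPriori`). From the apex Lipschitz law (hypothesis = the statement of the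
neighbouring stub `stub_apexLipschitz`): for every frame `R` (`n = R e₂`), height `c`, resolution `h > 0`
and smooth field `v` with cubic decay of `Dᵏv`, `k ≤ 3`, the unsigned planar flux of `f = ⟪curl v, n⟫`
through `R{x₂ = c}` splits as
`Φ(c) ≤ ‖f‖_{L¹(ℝ³)}/(2h) + liminf_{ε→0⁺} ∫⁻_{|⟪x,n⟫−c|<h} ofReal ((ε²/√(f²+ε²)³)|Df[curl v]|)` in `ℝ≥0∞`. -/
theorem stub_slabSplit :
    (∀ (ε : ℝ), 0 < ε → ∀ (R : EuclideanSpace ℝ (Fin 3) ≃ₗᵢ[ℝ] EuclideanSpace ℝ (Fin 3)) (c c' : ℝ)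
      (v : EuclideanSpace ℝ (Fin 3) → EuclideanSpace ℝ (Fin 3)), ContDiff ℝ (⊤ : ℕ∞) v →
      (∃ C : ℝ, ∀ (x : EuclideanSpace ℝ (Fin 3)) (k : ℕ), k ≤ 3 →
        (1 + ‖x‖) ^ 3 * ‖iteratedFDeriv ℝ k v x‖ ≤ C) →
      ∫ y : EuclideanSpace ℝ (Fin 2), inner ℝ (Literature.Analysis.FluidPDE.curl v
          (R (WithLp.toLp 2 ![y 0, y 1, c]))) (R (EuclideanSpace.single 2 1)) ^ 2 /
          Real.sqrt (inner ℝ (Literature.Analysis.FluidPDE.curl v (R (WithLp.toLp 2 ![y 0, y 1, c])))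
            (R (EuclideanSpace.single 2 1)) ^ 2 + ε ^ 2) ≤
      (∫ y : EuclideanSpace ℝ (Fin 2), inner ℝ (Literature.Analysis.FluidPDE.curl v
          (R (WithLp.toLp 2 ![y 0, y 1, c']))) (R (EuclideanSpace.single 2 1)) ^ 2 /
          Real.sqrt (inner ℝ (Literature.Analysis.FluidPDE.curl v (R (WithLp.toLp 2 ![y 0, y 1, c'])))
            (R (EuclideanSpace.single 2 1)) ^ 2 + ε ^ 2)) +
      ∫ x in {x : EuclideanSpace ℝ (Fin 3) | inner ℝ x (R (EuclideanSpace.single 2 1)) ∈ Set.uIcc c c'},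
        ε ^ 2 / Real.sqrt (inner ℝ (Literature.Analysis.FluidPDE.curl v x) (R (EuclideanSpace.single 2 1)) ^ 2
          + ε ^ 2) ^ 3 *
        |fderiv ℝ (fun z => inner ℝ (Literature.Analysis.FluidPDE.curl v z) (R (EuclideanSpace.single 2 1))) x
          (Literature.Analysis.FluidPDE.curl v x)|) →
    ∀ (R : EuclideanSpace ℝ (Fin 3) ≃ₗᵢ[ℝ] EuclideanSpace ℝ (Fin 3)) (c h : ℝ), 0 < h →
      ∀ (v : EuclideanSpace ℝ (Fin 3) → EuclideanSpace ℝ (Fin 3)), ContDiff ℝ (⊤ : ℕ∞) v →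
      (∃ C : ℝ, ∀ (x : EuclideanSpace ℝ (Fin 3)) (k : ℕ), k ≤ 3 →
        (1 + ‖x‖) ^ 3 * ‖iteratedFDeriv ℝ k v x‖ ≤ C) →
      ∫⁻ y : EuclideanSpace ℝ (Fin 2), ‖inner ℝ (Literature.Analysis.FluidPDE.curl v
          (R (WithLp.toLp 2 ![y 0, y 1, c]))) (R (EuclideanSpace.single 2 1))‖ₑ ≤
      ENNReal.ofReal (1 / (2 * h)) *
          (∫⁻ x, ‖inner ℝ (Literature.Analysis.FluidPDE.curl v x) (R (EuclideanSpace.single 2 1))‖ₑ) +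
        Filter.liminf (fun ε : ℝ => ∫⁻ x in {x : EuclideanSpace ℝ (Fin 3) |
            |inner ℝ x (R (EuclideanSpace.single 2 1)) - c| < h},
          ENNReal.ofReal (ε ^ 2 / Real.sqrt (inner ℝ (Literature.Analysis.FluidPDE.curl v x)
            (R (EuclideanSpace.single 2 1)) ^ 2 + ε ^ 2) ^ 3 *
            |fderiv ℝ (fun z => inner ℝ (Literature.Analysis.FluidPDE.curl v z) (R (EuclideanSpace.single 2 1)))
              x (Literature.Analysis.FluidPDE.curl v x)|)) (nhdsWithin 0 (Set.Ioi 0)) := by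
  intro hLip R c h hh v hv hdec
  obtain ⟨C, hC⟩ := hdec
  have hfc : Continuous fun x : EuclideanSpace ℝ (Fin 3) =>
      inner ℝ (curl v x) (R (EuclideanSpace.single 2 1)) :=
    (contDiff_inner_curl hv _).continuous
  exact slabSplit_core R c hh hfc.measurable
    (fun ε x => ε ^ 2 / Real.sqrt (inner ℝ (curl v x) (R (EuclideanSpace.single 2 1)) ^ 2 + ε ^ 2) ^ 3 *
      |fderiv ℝ (fun z => inner ℝ (curl v z) (R (EuclideanSpace.single 2 1))) x (curl v x)|)
    (fun ε hε => slabSplit_integrable R c hv hC hε _)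
    (fun ε hε c' => hLip ε hε R c c' v hv ⟨C, hC⟩)

end Summit.NavierStokesRegularity.NavierStokesRegularity.Theorems.SlicedKelvinPlanarFluxAPriori

end
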